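import Summits.NavierStokesRegularity.NavierStokesRegularity.Theorems.RungBlowupCofinal.BandLimitedCurl
import Summits.NavierStokesRegularity.NavierStokesRegularity.Theorems.RungBlowupCofinal.PureWaveExclusion
import Summits.NavierStokesRegularity.FluidComputer.AngularGalerkinLadderRotation
import Literature.Analysis.FluidPDE.IsometryInvariance
import HarnessLib

/-!
# SYMMETRY-ODD rung profiles are excluded: if a linear isometry `σ` commuting with `e₃ × ·`
# reverses the profile, `σU(σ⁻¹y) = −U(y)`, then `U ≡ 0` — every `α`, every `L`; in particular
# NO precessing rung profile is an EVEN field `U(−y) = U(y)`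
# (route `AngularGalerkinLadder`, crux K1 `RungBlowupCofinal`; admissibility filter N7, theorems only)

Cell `ns-blowup`, seat `ns-blowup-circuit` (g12, AGL Lean seat). Helper file for
`stmt-NavierStokesRegularity-19959`, line `Cruxes/RungBlowupCofinal/Lines/qlwave.lean`, series of
kernel admissibility filters N1–N6. The mechanism behind N6 (`SwirlOnlyProfilesExcluded`), made
general and stripped of every tangentiality hypothesis.

## The principle

Let `−ΔU + ½U + ½DU·y + αJ₃U + (U·∇)U + ∇Q = E` with `U` band-limited of degree `≤ L` and
divergence-free, `Q` smooth, `E` continuous and co-band-limited, `‖U(y)‖ ≤ C/(‖y‖+1)`. Let `σ` be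
a linear isometry of `ℝ³` and `σ̂V(y) = σV(σ⁻¹y)` the induced action on fields. Suppose
`σ̂U = −U` (the profile is `σ`-ODD) and `σ̂(J₃U) = −J₃U` (automatic when `σ` commutes with
`e₃ × ·`, `angGen_conj_of_comm` — e.g. `σ = −1`, rotations about `e₃`, the mirror `z ↦ −z` — or
when `J₃U = 0`). Then:
* the linear residual `G = −ΔU + ½U + ½DU·y + αJ₃U` is `σ`-odd (isometry covariance of `Δ` and
  of the radial derivative: `laplacian_conj_linearIsometryEquiv`, `fderiv_conj_linearIsometryEquiv`);
* the nonlinearity `(U·∇)U` is `σ`-EVEN — a bilinear expression in an odd field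
  (`convect_conj_of_odd`);
* reflecting the equation and subtracting, `G + ∇Q_odd = E_odd` with `Q_odd = ½(Q − Q∘σ⁻¹)` smooth
  and `E_odd = ½(E − σ̂E)` co-band-limited (`IsCobandLimited.conj_linearIsometryEquiv`): the profile
  solves the LINEAR precessing profile equation with a co-band defect, hence vanishes by the
  pure-wave Liouville theorem N1 (`eq_zero_of_linearProfile`: curl, Poincaré, rotating ansatz,
  ancient Stokes, KNSS duality).
In plain words: if `U` and `−U` are symmetry-related rung profiles, the nonlinearity cancels from
the odd part of the equation and nothing non-trivial survives the linear Liouville theorem.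

## Results

* `eq_zero_of_symmetryOdd` — the principle (hypotheses `σ̂U = −U`, `σ̂(J₃U) = −J₃U`);
* `eq_zero_of_symmetryOdd_of_comm` — with `σ (e₃ × w) = e₃ × σw` instead of the `J₃` hypothesis;
* **`eq_zero_of_even`** — `σ = −1`: a precessing rung profile with `U(−y) = U(y)` for all `y` is
  trivial (every `α`, every `L`); `rungProfile_eq_zero_of_even` in the letters of
  `Qlwave.IsPrecessingRungProfile`.
(N6's swirl-only exclusion is the instance `σ = reflY`, `J₃U = 0`.)

LABEL: KERNEL, unconditional. WHAT THIS IS NOT: not Navier–Stokes evidence; no profile is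
constructed; profiles without such an odd symmetry (the generic mean–wave profile `V + W`) are
untouched. References: [cite: MajdaBertozziCUP2002, §1.2 Prop. 1.1] (isometry covariance of the
Navier–Stokes nonlinearity and Laplacian); [cite: KochNadirashviliSereginSverak2009, §1 (1.5)]
(the generator `J₃`); [cite: PineauVicol2026, (1.7)] (the precessing ansatz behind the profile
system).
-/

noncomputable section

namespace Summit.NavierStokesRegularity.AngularGalerkinLadderOddProfilesExcluded

open Set Function
open scoped ContDiff RealInnerProductSpace Laplacian
open Literature.Analysis.FluidPDE
open Summit.NavierStokesRegularity.FluidComputer Summit.NavierStokesRegularity.FluidComputer.AngularLadder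
open Summit.NavierStokesRegularity.AngularGalerkinLadderBandLimitedCurl
open Summit.NavierStokesRegularity.AngularGalerkinLadderPureWaveExclusion

variable {L : ℕ} {α C : ℝ}
  {U E : EuclideanSpace ℝ (Fin 3) → EuclideanSpace ℝ (Fin 3)} {Q : EuclideanSpace ℝ (Fin 3) → ℝ}
  (σ : EuclideanSpace ℝ (Fin 3) ≃ₗᵢ[ℝ] EuclideanSpace ℝ (Fin 3))

/-! ## §1 The induced action `σ̂V(y) = σV(σ⁻¹y)` on derivatives, generator and nonlinearity -/

/-- Chain rule for the conjugate field, applied: `D(σ̂V)(y) w = σ(DV(σ⁻¹y)(σ⁻¹w))`. [folklore] -/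
theorem fderiv_conj_apply (V : EuclideanSpace ℝ (Fin 3) → EuclideanSpace ℝ (Fin 3))
    (y w : EuclideanSpace ℝ (Fin 3)) :
    fderiv ℝ (fun z => σ (V (σ.symm z))) y w = σ (fderiv ℝ V (σ.symm y) (σ.symm w)) := by
  rw [fderiv_conj_linearIsometryEquiv σ V y]
  rfl

/-- **An odd field has an even self-advection**: `σ̂U = −U` implies
`σ((U·∇)U(σ⁻¹y)) = (U·∇)U(y)`. [folklore] -/
theorem convect_conj_of_odd (hodd : ∀ y, σ (U (σ.symm y)) = -U y) (y : EuclideanSpace ℝ (Fin 3)) :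
    σ (convect U U (σ.symm y)) = convect U U y := by
  have hconj : (fun z => σ (U (σ.symm z))) = -U := funext fun z => by rw [hodd z]; rfl
  have h1 : σ (fderiv ℝ U (σ.symm y) (U (σ.symm y))) =
      fderiv ℝ (fun z => σ (U (σ.symm z))) y (σ (U (σ.symm y))) := by
    rw [fderiv_conj_apply, σ.symm_apply_apply]
  rw [convect_apply, convect_apply, h1, hodd y, hconj, fderiv_neg, map_neg]
  simp

/-- `J₃(−V) = −J₃V`. [folklore] -/
theorem angGen_neg_field (a : Fin 3) (V : EuclideanSpace ℝ (Fin 3) → EuclideanSpace ℝ (Fin 3))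
    (y : EuclideanSpace ℝ (Fin 3)) : angGen a (-V) y = -angGen a V y := by
  rw [angGen_eq, angGen_eq]
  simp only [Pi.neg_apply, map_neg, fderiv_neg, _root_.neg_apply]
  abel

/-- **`J₃` commutes with `σ̂` when `σ` commutes with `e₃ × ·`**:
`σ(J₃V)(σ⁻¹y) = J₃(σ̂V)(y)`. [folklore] -/
theorem angGen_conj_of_comm (hσe : ∀ w, σ (crossCLM (axis 2) w) = crossCLM (axis 2) (σ w))
    (V : EuclideanSpace ℝ (Fin 3) → EuclideanSpace ℝ (Fin 3)) (y : EuclideanSpace ℝ (Fin 3)) :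
    σ (angGen 2 V (σ.symm y)) = angGen 2 (fun z => σ (V (σ.symm z))) y := by
  have hσe' : σ.symm (crossCLM (axis 2) y) = crossCLM (axis 2) (σ.symm y) := by
    apply σ.injective
    rw [σ.apply_symm_apply, hσe, σ.apply_symm_apply]
  rw [angGen_eq, angGen_eq]
  simp only [map_sub, hσe, fderiv_conj_apply, hσe']

/-- Hence an odd field has an odd generator image when `σ` commutes with `e₃ × ·`. [folklore] -/
theorem angGen_conj_of_odd_of_comm
    (hσe : ∀ w, σ (crossCLM (axis 2) w) = crossCLM (axis 2) (σ w))
    (hodd : ∀ y, σ (U (σ.symm y)) = -U y) (y : EuclideanSpace ℝ (Fin 3)) :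
    σ (angGen 2 U (σ.symm y)) = -angGen 2 U y := by
  have hconj : (fun z => σ (U (σ.symm z))) = -U := funext fun z => by rw [hodd z]; rfl
  rw [angGen_conj_of_comm σ hσe, hconj, angGen_neg_field]

/-! ## §2 The odd part of the equation is linear with a co-band defect -/

/-- **Odd/even splitting.** From `G + N + ∇Q = E` with `G` odd, `N` even, `Q` smooth and `E`
continuous co-band-limited: `G + ∇Q_odd = E_odd` with `Q_odd` smooth and `E_odd`
co-band-limited. [folklore] -/
theorem exists_odd_split {G N : EuclideanSpace ℝ (Fin 3) → EuclideanSpace ℝ (Fin 3)}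
    (hQ : ContDiff ℝ ∞ Q) (hE : IsCobandLimited L E) (hEc : Continuous E)
    (heq : ∀ y, G y + N y + gradient Q y = E y)
    (hGodd : ∀ y, σ (G (σ.symm y)) = -G y) (hNeven : ∀ y, σ (N (σ.symm y)) = N y) :
    ∃ (Q' : EuclideanSpace ℝ (Fin 3) → ℝ) (E' : EuclideanSpace ℝ (Fin 3) → EuclideanSpace ℝ (Fin 3)),
      ContDiff ℝ ∞ Q' ∧ IsCobandLimited L E' ∧ ∀ y, G y + gradient Q' y = E' y := by
  have heq' : ∀ y, -G y + N y + gradient (fun z => Q (σ.symm z)) y = σ (E (σ.symm y)) := by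
    intro y
    rw [gradient_comp_linearIsometryEquiv_symm σ Q y, ← hGodd y, ← hNeven y, ← map_add,
      ← map_add, heq (σ.symm y)]
  have hQσ : ContDiff ℝ ∞ (fun z => Q (σ.symm z)) :=
    hQ.comp σ.symm.toContinuousLinearEquiv.contDiff
  refine ⟨fun z => (1 / 2 : ℝ) * (Q z - Q (σ.symm z)),
    fun z => (1 / 2 : ℝ) • (E z - σ (E (σ.symm z))), contDiff_const.mul (hQ.sub hQσ), ?_, ?_⟩
  · have hEσc : Continuous (fun y => σ (E (σ.symm y))) :=
      σ.continuous.comp (hEc.comp σ.symm.continuous)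
    have h := (hE.add (hE.conj_linearIsometryEquiv σ).neg hEc hEσc.neg).smul (1 / 2 : ℝ)
    have e : (fun z => (1 / 2 : ℝ) • (E z - σ (E (σ.symm z)))) =
        (1 / 2 : ℝ) • (E + -fun y => σ (E (σ.symm y))) := by
      funext z
      simp only [Pi.smul_apply, Pi.add_apply, Pi.neg_apply, sub_eq_add_neg]
    rw [e]
    exact h
  · intro y
    show _ = (1 / 2 : ℝ) • (E y - σ (E (σ.symm y)))
    have hd1 : DifferentiableAt ℝ Q y := (hQ.differentiable (by simp)) y
    have hd2 : DifferentiableAt ℝ (fun z => Q (σ.symm z)) y := (hQσ.differentiable (by simp)) y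
    have hg : gradient (fun z => (1 / 2 : ℝ) * (Q z - Q (σ.symm z))) y =
        (1 / 2 : ℝ) • (gradient Q y - gradient (fun z => Q (σ.symm z)) y) := by
      simp only [gradient, fderiv_const_mul (hd1.fun_sub hd2), fderiv_fun_sub hd1 hd2, map_smul,
        map_sub]
    rw [hg, ← heq y, ← heq' y]
    module

/-! ## §3 The exclusion theorems -/

/-- **SYMMETRY-ODD PROFILES EXCLUDED.** Let `U` be band-limited of degree `≤ L` and
divergence-free, `Q` smooth, `E` continuous and co-band-limited,
`−ΔU + ½U + ½DU·y + αJ₃U + (U·∇)U + ∇Q = E`, `‖U(y)‖ ≤ C/(‖y‖+1)`. If a linear isometry `σ`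
reverses both the profile and its generator image — `σU(σ⁻¹y) = −U(y)`,
`σ(J₃U)(σ⁻¹y) = −(J₃U)(y)` — then `U = 0` (every `α`, every `L`). [folklore] -/
theorem eq_zero_of_symmetryOdd (hU : IsBandLimited L U) (hdiv : VectorCalculus.IsDivFree U)
    (hQ : ContDiff ℝ ∞ Q) (hE : IsCobandLimited L E) (hEc : Continuous E)
    (heq : ∀ y, -(Δ U) y + (1 / 2 : ℝ) • U y + (1 / 2 : ℝ) • fderiv ℝ U y y + α • angGen 2 U y +
      convect U U y + gradient Q y = E y)
    (hdec : ∀ y, ‖U y‖ ≤ C / (‖y‖ + 1))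
    (hodd : ∀ y, σ (U (σ.symm y)) = -U y)
    (hJodd : ∀ y, σ (angGen 2 U (σ.symm y)) = -angGen 2 U y) : U = 0 := by
  -- the linear residual and its oddness
  set G : EuclideanSpace ℝ (Fin 3) → EuclideanSpace ℝ (Fin 3) := fun y =>
    -((1 : ℝ) • (Δ U) y) + (1 / 2 : ℝ) • U y + (1 / 2 : ℝ) • fderiv ℝ U y y + α • angGen 2 U y
    with hG
  have heqG : ∀ y, G y + convect U U y + gradient Q y = E y := fun y => by
    simp only [hG, one_smul]; exact heq y
  have hconj : (fun y => σ (U (σ.symm y))) = -U := funext fun y => by rw [hodd y]; rfl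
  have hΔ : ∀ y, σ ((Δ U) (σ.symm y)) = -(Δ U) y := fun y => by
    rw [← laplacian_conj_linearIsometryEquiv σ U y, hconj, InnerProductSpace.laplacian_neg]
    rfl
  have hD : ∀ y, σ (fderiv ℝ U (σ.symm y) (σ.symm y)) = -(fderiv ℝ U y y) := fun y => by
    rw [← fderiv_conj_apply σ U y y, hconj, fderiv_neg]; rfl
  have hGodd : ∀ y, σ (G (σ.symm y)) = -G y := fun y => by
    simp only [hG, one_smul, map_add, map_neg, map_smul, hΔ, hD, hodd, hJodd, smul_neg, neg_neg,
      neg_add]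
  -- the odd part of the equation: linear, co-band defect
  obtain ⟨Q', E', hQ', hE', hlin⟩ :=
    exists_odd_split σ hQ hE hEc heqG hGodd (convect_conj_of_odd σ hodd)
  have hlin' : ∀ y, -(Δ U) y + (1 / 2 : ℝ) • U y + (1 / 2 : ℝ) • fderiv ℝ U y y + α • angGen 2 U y +
      gradient Q' y = E' y := fun y => by
    have h := hlin y
    simp only [hG, one_smul] at h
    exact h
  exact eq_zero_of_linearProfile hU hdiv hQ' hE' hlin' hdec

/-- **The same with the commutation hypothesis** `σ(e₃ × w) = e₃ × σw` (so that `J₃` commutes with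
`σ̂`) in place of the hypothesis on `J₃U`. [folklore] -/
theorem eq_zero_of_symmetryOdd_of_comm (hσe : ∀ w, σ (crossCLM (axis 2) w) = crossCLM (axis 2) (σ w))
    (hU : IsBandLimited L U) (hdiv : VectorCalculus.IsDivFree U)
    (hQ : ContDiff ℝ ∞ Q) (hE : IsCobandLimited L E) (hEc : Continuous E)
    (heq : ∀ y, -(Δ U) y + (1 / 2 : ℝ) • U y + (1 / 2 : ℝ) • fderiv ℝ U y y + α • angGen 2 U y +
      convect U U y + gradient Q y = E y)
    (hdec : ∀ y, ‖U y‖ ≤ C / (‖y‖ + 1))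
    (hodd : ∀ y, σ (U (σ.symm y)) = -U y) : U = 0 :=
  eq_zero_of_symmetryOdd σ hU hdiv hQ hE hEc heq hdec hodd (angGen_conj_of_odd_of_comm σ hσe hodd)

/-- **The same for ZONAL profiles** (`J₃U = 0`): any linear isometry reversing `U` suffices.
[folklore] -/
theorem eq_zero_of_symmetryOdd_of_zonal (hU : IsBandLimited L U) (hdiv : VectorCalculus.IsDivFree U)
    (hQ : ContDiff ℝ ∞ Q) (hE : IsCobandLimited L E) (hEc : Continuous E)
    (heq : ∀ y, -(Δ U) y + (1 / 2 : ℝ) • U y + (1 / 2 : ℝ) • fderiv ℝ U y y + α • angGen 2 U y +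
      convect U U y + gradient Q y = E y)
    (hdec : ∀ y, ‖U y‖ ≤ C / (‖y‖ + 1))
    (hzonal : ∀ y, angGen 2 U y = 0)
    (hodd : ∀ y, σ (U (σ.symm y)) = -U y) : U = 0 :=
  eq_zero_of_symmetryOdd σ hU hdiv hQ hE hEc heq hdec hodd (fun y => by simp [hzonal])

/-! ## §4 `σ = −1`: no precessing rung profile is an even field -/

/-- **EVEN PROFILES EXCLUDED.** A precessing rung profile that is an even field,
`U(−y) = U(y)` for all `y` — band-limited, divergence-free, smooth pressure, continuous co-band
defect, `−ΔU + ½U + ½DU·y + αJ₃U + (U·∇)U + ∇Q = E`, Type-I tail — vanishes identically,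
for every precession rate `α` and every level `L` (`σ = −1` is central: it commutes with
`e₃ × ·`, and `σ̂U(y) = −U(−y) = −U(y)`). [folklore] -/
theorem eq_zero_of_even (hU : IsBandLimited L U) (hdiv : VectorCalculus.IsDivFree U)
    (hQ : ContDiff ℝ ∞ Q) (hE : IsCobandLimited L E) (hEc : Continuous E)
    (heq : ∀ y, -(Δ U) y + (1 / 2 : ℝ) • U y + (1 / 2 : ℝ) • fderiv ℝ U y y + α • angGen 2 U y +
      convect U U y + gradient Q y = E y)
    (hdec : ∀ y, ‖U y‖ ≤ C / (‖y‖ + 1))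
    (heven : ∀ y, U (-y) = U y) : U = 0 := by
  refine eq_zero_of_symmetryOdd_of_comm (LinearIsometryEquiv.neg ℝ) (fun w => ?_) hU hdiv hQ hE hEc
    heq hdec (fun y => ?_)
  · simp [LinearIsometryEquiv.coe_neg, map_neg]
  · simp [LinearIsometryEquiv.symm_neg, LinearIsometryEquiv.coe_neg, heven]

/-- **Even profiles excluded, in the letters of `Qlwave.IsPrecessingRungProfile L α C U Q E`**
(`precResidual α U Q E y = 0` unfolded). [folklore] -/
theorem rungProfile_eq_zero_of_even (hU : IsBandLimited L U) (hdiv : VectorCalculus.IsDivFree U)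
    (hQ : ContDiff ℝ ∞ Q) (hEc : Continuous E) (hE : IsCobandLimited L E)
    (hres : ∀ y, -(Δ U) y + (1 / 2 : ℝ) • U y + (1 / 2 : ℝ) • fderiv ℝ U y y + α • angGen 2 U y +
      convect U U y + gradient Q y - E y = 0)
    (hdec : ∀ y, ‖U y‖ ≤ C / (‖y‖ + 1)) (heven : ∀ y, U (-y) = U y) : ∀ y, U y = 0 := by
  intro y
  rw [eq_zero_of_even hU hdiv hQ hE hEc (fun y => sub_eq_zero.1 (hres y)) hdec heven]
  rfl

/-- **Symmetry-odd profiles excluded, in the letters of `IsPrecessingRungProfile`** (general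
`σ` commuting with `e₃ × ·`; e.g. the mirror `z ↦ −z` or `−1`). [folklore] -/
theorem rungProfile_eq_zero_of_symmetryOdd
    (hσe : ∀ w, σ (crossCLM (axis 2) w) = crossCLM (axis 2) (σ w))
    (hU : IsBandLimited L U) (hdiv : VectorCalculus.IsDivFree U)
    (hQ : ContDiff ℝ ∞ Q) (hEc : Continuous E) (hE : IsCobandLimited L E)
    (hres : ∀ y, -(Δ U) y + (1 / 2 : ℝ) • U y + (1 / 2 : ℝ) • fderiv ℝ U y y + α • angGen 2 U y +
      convect U U y + gradient Q y - E y = 0)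
    (hdec : ∀ y, ‖U y‖ ≤ C / (‖y‖ + 1)) (hodd : ∀ y, σ (U (σ.symm y)) = -U y) : ∀ y, U y = 0 := by
  intro y
  rw [eq_zero_of_symmetryOdd_of_comm σ hσe hU hdiv hQ hE hEc (fun y => sub_eq_zero.1 (hres y))
    hdec hodd]
  rfl

end Summit.NavierStokesRegularity.AngularGalerkinLadderOddProfilesExcluded

end
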